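import Summits.CriticalPhenomena.SAWScalingLimit.Theorems.SAWDevelopingMapHexConjectureWindowTwoPointOfReg
import HarnessLib

/-!
# Crux `HexConjecture` (stmt-CriticalPhenomena-0808), line `root-locality-replaces-loewner`:
the window two-point lower bound from DOUBLING of the triangle tail AT LARGE SCALES

Landing target:
`Summits/CriticalPhenomena/SAWScalingLimit/Theorems/SAWDevelopingMapHexConjectureDoublingEventually.lean`
(`--supports stmt-CriticalPhenomena-0808`; registered sub-goal `stub_windowTwoPointLowerBound_of_doublingEventually`;
lead prover-line-stmt-CriticalPhenomena-0808-c10-0).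

The lever of the line is the WINDOW TWO-POINT LOWER BOUND `WTLB` (skeleton statement 2♮♮); seat c9 reduced it
to the lower regularity `REG : ∃ C, ∀ T ≥ 1, Σ_{i ≤ T} triDl i ≤ C (T+1) triDl T` of the Glazman–Manolescu
triangle tail (`stub_windowTwoPointLowerBound_of_reg`) and showed that DOUBLING for all `T ≥ 1` with some
`q > 1/2` (`q · triDl T ≤ triDl (2T)`) gives REG (`reg_of_doubling`).  This file removes the small scales from
that sufficient condition: doubling at all LARGE scales `T ≥ T₀` suffices (`reg_of_doublingEventually`,
`windowTwoPointLowerBound_of_doublingEventually`).  Proof: the rescaled sequence `b n := triDl (n T₀)` doubles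
for all `n ≥ 1`, so `reg_of_doubling` applies to `b`; the partial sums of `triDl` are compared block-wise
with those of `b` (`doublingEv_blockSum`, monotonicity), `triDl T ≥ q · b ⌊T/T₀⌋` on `[T₀, ∞)`, and the
finitely many `T < T₀` are absorbed by the constant `triDl 0 / triDl T₀`.  This is the numerics-facing form
of the lever's sufficient condition: the predicted ratio is `triDl(2T)/triDl T → 2^(-1/4) ≈ 0.84` and the
measured one `≈ 0.85` (`T ≤ 16`, seat c8); only `> 1/2` eventually is needed.
-/

noncomputable section

open scoped BigOperators Topology Classical
open Finset
open Literature.Probability.LatticeModels (HexVertex hexGraph hexCenter Site)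
open Literature.Probability.RandomPlanarGeometry
open Literature.Probability.RandomPlanarGeometry.SAW
open Literature.Probability.RandomPlanarGeometry.SAW.HV

namespace Summit.CriticalPhenomena.SAWScalingLimit.Theorems.HexConjecture.RootLocality

/-! ### Robust sufficient forms: doubling at large scales -/

/-- Block comparison for a non-increasing sequence: the sum of `triDl` over the first `(n+1) T₀`
indices is at most `T₀` times the sum of its values at the block starts `j T₀`, `j ≤ n`. [folklore] -/
theorem doublingEv_blockSum (T₀ : ℕ) : ∀ n : ℕ,
    ∑ i ∈ range ((n + 1) * T₀), triDl i ≤ ∑ j ∈ range (n + 1), (T₀ : ℝ) * triDl (j * T₀) := by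
  intro n
  induction n with
  | zero =>
    rw [zero_add, one_mul, sum_range_one, zero_mul]
    calc ∑ i ∈ range T₀, triDl i ≤ ∑ _i ∈ range T₀, triDl 0 :=
          sum_le_sum fun i _ => triDl_antitone (Nat.zero_le i)
      _ = (T₀ : ℝ) * triDl 0 := by rw [sum_const, card_range, nsmul_eq_mul]
  | succ n ih =>
    have e : (n + 1 + 1) * T₀ = (n + 1) * T₀ + T₀ := by ring
    rw [e, sum_range_add, sum_range_succ _ (n + 1)]
    refine add_le_add ih ?_
    calc ∑ i ∈ range T₀, triDl ((n + 1) * T₀ + i) ≤ ∑ _i ∈ range T₀, triDl ((n + 1) * T₀) :=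
          sum_le_sum fun i _ => triDl_antitone (Nat.le_add_right _ _)
      _ = (T₀ : ℝ) * triDl ((n + 1) * T₀) := by rw [sum_const, card_range, nsmul_eq_mul]

/-- **Lower regularity from doubling at LARGE scales.**  If `a = triDl` satisfies `q · a T ≤ a (2T)`
for all `T ≥ T₀` (`T₀ ≥ 1`) with some `q > 1/2`, then `Σ_{i ≤ T} a i ≤ C (T+1) a T` for all `T ≥ 1`:
rescale to `b n := a (n T₀)`, which doubles for all `n ≥ 1`, apply `reg_of_doubling` to `b`, and
compare block-wise (`a` is non-increasing, `a T ≥ q · a (⌊T/T₀⌋ T₀)` on `[T₀, ∞)`, and the finitely many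
small `T` are absorbed by `a 0 / a T₀`). [folklore] -/
theorem reg_of_doublingEventually {q : ℝ} (hq : 1 / 2 < q) {T₀ : ℕ} (hT₀ : 1 ≤ T₀)
    (hd : ∀ T : ℕ, T₀ ≤ T → q * triDl T ≤ triDl (2 * T)) :
    ∃ C : ℝ, ∀ T : ℕ, 1 ≤ T → ∑ i ∈ range (T + 1), triDl i ≤ C * ((T : ℝ) + 1) * triDl T := by
  have hq0 : 0 < q := by linarith
  -- the rescaled sequence
  set b : ℕ → ℝ := fun n => triDl (n * T₀) with hb
  have hbpos : ∀ n, 0 < b n := fun n => stub_triDl_pos _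
  have hbmono : Antitone b := fun n m h => triDl_antitone (Nat.mul_le_mul_right T₀ h)
  have hbd : ∀ n : ℕ, 1 ≤ n → q * b n ≤ b (2 * n) := by
    intro n hn
    have h := hd (n * T₀) (by nlinarith)
    have e : 2 * (n * T₀) = 2 * n * T₀ := by ring
    rw [e] at h
    exact h
  obtain ⟨C, hC⟩ := reg_of_doubling hbpos hbmono hq hbd
  have ha0 : 0 < triDl 0 := stub_triDl_pos 0
  have haT₀ : 0 < triDl T₀ := stub_triDl_pos T₀
  -- `C > 0` from the instance `n = 1` of the regularity of `b`
  have hC0 : 0 ≤ C := by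
    have h := hC 1 le_rfl
    have hb0 := hbpos 0
    have hb1 := hbpos 1
    have hs : ∑ i ∈ range (1 + 1), b i = b 0 + b 1 := by simp [sum_range_succ]
    rw [hs] at h
    by_contra hneg
    push Not at hneg
    have : C * (((1 : ℕ) : ℝ) + 1) * b 1 < 0 :=
      mul_neg_of_neg_of_pos (mul_neg_of_neg_of_pos hneg (by positivity)) hb1
    linarith
  refine ⟨max (2 * T₀ * C / q) (triDl 0 / triDl T₀), fun T _hT => ?_⟩
  rcases lt_or_ge T T₀ with hlt | hge
  · -- small `T`: `Σ ≤ (T+1) a 0 ≤ (a 0 / a T₀) (T+1) a T`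
    have haT : triDl T₀ ≤ triDl T := triDl_antitone hlt.le
    calc ∑ i ∈ range (T + 1), triDl i ≤ ∑ _i ∈ range (T + 1), triDl 0 :=
          sum_le_sum fun i _ => triDl_antitone (Nat.zero_le i)
      _ = ((T : ℝ) + 1) * triDl 0 := by rw [sum_const, card_range, nsmul_eq_mul]; push_cast; ring
      _ = triDl 0 / triDl T₀ * ((T : ℝ) + 1) * triDl T₀ := by field_simp
      _ ≤ triDl 0 / triDl T₀ * ((T : ℝ) + 1) * triDl T :=
          mul_le_mul_of_nonneg_left haT (by positivity)
      _ ≤ max (2 * T₀ * C / q) (triDl 0 / triDl T₀) * ((T : ℝ) + 1) * triDl T :=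
          mul_le_mul_of_nonneg_right
            (mul_le_mul_of_nonneg_right (le_max_right _ _) (by positivity)) (triDl_nonneg T)
  · -- large `T`: blocks of length `T₀`
    set n : ℕ := T / T₀ with hn
    have hT₀0 : 0 < T₀ := hT₀
    have hn1 : 1 ≤ n := (Nat.one_le_div_iff hT₀0).2 hge
    have hnT : n * T₀ ≤ T := Nat.div_mul_le_self T T₀
    have hTn : T < (n + 1) * T₀ := (Nat.div_lt_iff_lt_mul hT₀0).1 (Nat.lt_succ_self _)
    -- every index `i ≤ T` lies in a block `[j T₀, (j+1) T₀)` with `j ≤ n`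
    have hblock : ∑ i ∈ range (T + 1), triDl i ≤ ∑ j ∈ range (n + 1), (T₀ : ℝ) * b j :=
      calc ∑ i ∈ range (T + 1), triDl i ≤ ∑ i ∈ range ((n + 1) * T₀), triDl i :=
            sum_le_sum_of_subset_of_nonneg (range_mono (by omega)) fun i _ _ => triDl_nonneg i
        _ ≤ ∑ j ∈ range (n + 1), (T₀ : ℝ) * b j := doublingEv_blockSum T₀ n
    have hregb := hC n hn1
    -- `q · b n ≤ a T`: `T < (n+1) T₀ ≤ 2 n T₀`, so `a T ≥ a (2 n T₀) = b (2n) ≥ q · b n`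
    have hbn : q * b n ≤ triDl T :=
      calc q * b n ≤ b (2 * n) := hbd n hn1
        _ ≤ triDl T := triDl_antitone (by
            show T ≤ 2 * n * T₀
            nlinarith)
    have hnT' : ((n : ℝ) + 1) ≤ ((T : ℝ) + 1) := by
      have : n ≤ T := le_trans (Nat.le_mul_of_pos_right n hT₀0) hnT
      exact_mod_cast Nat.succ_le_succ this
    have h0 : 0 ≤ (T₀ : ℝ) * C / q := by positivity
    calc ∑ i ∈ range (T + 1), triDl i ≤ ∑ j ∈ range (n + 1), (T₀ : ℝ) * b j := hblock
      _ = (T₀ : ℝ) * ∑ j ∈ range (n + 1), b j := by rw [mul_sum]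
      _ ≤ (T₀ : ℝ) * (C * ((n : ℝ) + 1) * b n) := mul_le_mul_of_nonneg_left hregb (Nat.cast_nonneg _)
      _ = ((T₀ : ℝ) * C / q) * ((n : ℝ) + 1) * (q * b n) := by field_simp
      _ ≤ ((T₀ : ℝ) * C / q) * ((T : ℝ) + 1) * triDl T :=
          mul_le_mul (mul_le_mul_of_nonneg_left hnT' h0) hbn (mul_pos hq0 (hbpos n)).le
            (mul_nonneg h0 (by positivity))
      _ ≤ max (2 * T₀ * C / q) (triDl 0 / triDl T₀) * ((T : ℝ) + 1) * triDl T := by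
          refine mul_le_mul_of_nonneg_right (mul_le_mul_of_nonneg_right ?_ (by positivity))
            (triDl_nonneg T)
          calc (T₀ : ℝ) * C / q ≤ 2 * T₀ * C / q := by
                rw [div_le_div_iff_of_pos_right hq0]; nlinarith [Nat.cast_nonneg (α := ℝ) T₀]
            _ ≤ _ := le_max_left _ _

/-- **`WTLB` from doubling at LARGE scales**: if `q · triDl T ≤ triDl (2T)` for all `T ≥ T₀` with some
`q > 1/2` (predicted ratio `2^(-1/4) ≈ 0.84`; numerically `≈ 0.85` for `T ≤ 48`, seat c8), then the
window two-point lower bound holds. [cite: KrachunPanagiotis2026, §3; GlazmanManolescu2019, §4.1] -/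
theorem windowTwoPointLowerBound_of_doublingEventually {q : ℝ} (hq : 1 / 2 < q) {T₀ : ℕ}
    (hd : ∀ T : ℕ, T₀ ≤ T → q * triDl T ≤ triDl (2 * T)) :
    ∃ θa θb C : ℝ, 0 < θa ∧ θa < θb ∧ θb ≤ 1 / 4 ∧ 0 < C ∧ ∃ R₀ : ℝ, 0 < R₀ ∧ ∀ R : ℝ, R₀ ≤ R → ∀ (x : Literature.Probability.LatticeModels.Site 2) (B : Finset Literature.Probability.LatticeModels.HexVertex) (S' : Finset ℤ), (∀ v : Literature.Probability.LatticeModels.HexVertex, v ∈ B ↔ (x 1 ≤ v.1 1 ∧ dist (Literature.Probability.LatticeModels.hexCenter v) (Literature.Probability.RandomPlanarGeometry.SAW.hexMidpoint s((x - Pi.single 1 1, 1), (x, 0))) ≤ R)) → (∀ d : ℤ, d ∈ S' ↔ (θa * R ≤ (d : ℝ) ∧ (d : ℝ) ≤ θb * R)) → Literature.Probability.RandomPlanarGeometry.SAW.HV.triDl ⌊R / 4⌋₊ ≤ C * ∑ d ∈ S', ∑ γ : Literature.Probability.RandomPlanarGeometry.SAW.HexMidEdgeSAW B s((x - Pi.single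 1 1, 1), (x, 0)) s((x + Pi.single 0 d - Pi.single 1 1, 1), (x + Pi.single 0 d, 0)), Literature.Probability.RandomPlanarGeometry.SAW.hexCriticalFugacity ^ γ.length :=
  stub_windowTwoPointLowerBound_of_reg
    (reg_of_doublingEventually hq (le_max_right T₀ 1)
      (fun T hT => hd T ((le_max_left T₀ 1).trans hT)))

/-- **Registered sub-goal `stub_windowTwoPointLowerBound_of_doublingEventually`** (crux item
stmt-CriticalPhenomena-0808, line `root-locality-replaces-loewner`): `WTLB` from doubling of the triangle tail
at large scales — for every `q > 1/2` and `T₀`, if `q · triDl T ≤ triDl (2T)` for all `T ≥ T₀` then the window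
two-point lower bound holds. [cite: KrachunPanagiotis2026, §3; GlazmanManolescu2019, §4.1] -/
theorem stub_windowTwoPointLowerBound_of_doublingEventually : ∀ (q : ℝ), 1 / 2 < q → ∀ (T₀ : ℕ), (∀ T : ℕ, T₀ ≤ T → q * Literature.Probability.RandomPlanarGeometry.SAW.HV.triDl T ≤ Literature.Probability.RandomPlanarGeometry.SAW.HV.triDl (2 * T)) → ∃ θa θb C : ℝ, 0 < θa ∧ θa < θb ∧ θb ≤ 1 / 4 ∧ 0 < C ∧ ∃ R₀ : ℝ, 0 < R₀ ∧ ∀ R : ℝ, R₀ ≤ R → ∀ (x : Literature.Probability.LatticeModels.Site 2) (B : Finset Literature.Probability.LatticeModels.HexVertex) (S' : Finset ℤ), (∀ v : Literature.Probability.LatticeModels.HexVertex, v ∈ B ↔ (x 1 ≤ v.1 1 ∧ dist (Literature.Probability.LatticeModels.hexCenter v) (Literature.Probability.RandomPlanarGeometry.SAW.hexMidpoint s((x - Pi.single 1 1, 1), (x, 0))) ≤ R)) → (∀ d : ℤ, d ∈ S' ↔ (θa * R ≤ (d : ℝ) ∧ (d : ℝ) ≤ θb * R)) → Literature.Probability.RandomPlanarGeometry.SAW.HV.triDl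 ⌊R / 4⌋₊ ≤ C * ∑ d ∈ S', ∑ γ : Literature.Probability.RandomPlanarGeometry.SAW.HexMidEdgeSAW B s((x - Pi.single 1 1, 1), (x, 0)) s((x + Pi.single 0 d - Pi.single 1 1, 1), (x + Pi.single 0 d, 0)), Literature.Probability.RandomPlanarGeometry.SAW.hexCriticalFugacity ^ γ.length :=
  fun _q hq _T₀ hd => windowTwoPointLowerBound_of_doublingEventually hq hd

end Summit.CriticalPhenomena.SAWScalingLimit.Theorems.HexConjecture.RootLocality

end
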